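import Literature.AlgebraicGeometry.ComplexMultiplication.EndFieldCMOfSimpleOverNumberField
import Literature.NumberTheory.ComplexMultiplication.EllipticCurveEndomorphismsBaseChange
import Literature.RingTheory.CentralSimple.AlbertTypes
import Mathlib.LinearAlgebra.Trace
import Mathlib.LinearAlgebra.Basis.VectorSpace
import HarnessLib

/-!
# The Rosati involution: `End⁰_E(B)` of an abelian variety over a number field carries a POSITIVE ANTI-INVOLUTION
# (Mumford §20 p. 189, §21 Thm. 1; Shimura 1998 §1.3, §5.1; Lange Thm. 2.4.9 / Lang VII Thm. 5.3)

Layer `Literature/AlgebraicGeometry/ComplexMultiplication`, namespace `Literature.AlgebraicGeometry.ComplexMultiplication`.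
THEOREMS ONLY: no definition, no instance, no named fact, no `sorry` (net Literature debt 0).

THE PRINT.  D. Mumford, *Abelian Varieties* (1970), §20 p. 189: the Rosati involution `φ ↦ φ′ = λ⁻¹ φ̂ λ` of `End⁰(X)`
attached to a polarisation `λ`, an anti-involution; §21 Thm. 1: «`Tr(φ φ′) > 0` if `φ ≠ 0`» (the trace form taken in the
rational representation, equivalently — up to a positive factor on each simple factor — in the regular representation);
G. Shimura (1998) §1.3 / §5.1 p. 38: «`End_Q(B)` has an involution `ξ ↦ ξ'` with the property `tr(ξξ') > 0`»; S. Lang,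
*Introduction to Algebraic and Abelian Functions*, VII §5 Thm. 5.3: `λ'` is the `Re H`-adjoint of `λ`, «the positivity
statement also applies to the rational representation».

WHAT IS PROVED — in the tree's vocabulary `RingTheory.CentralSimple.IsPositiveAntiInvolution D τ` (`τ(yz) = τ z · τ y`,
`τ(τ y) = y`, `0 < leftMulTrace ℚ D (τ y · y)` for `y ≠ 0`, Lange §2.6.2):

* §1 `leftMulTrace_pos_of_adjoint_repr` — POSITIVITY TRANSFER, pure linear algebra: for an injective `ψ : D → M_n(ℚ)` of a
  finite-dimensional `ℚ`-algebra, a positive-definite real `S` and a `ℚ`-linear `τ` with `ψ(τ x) = S⁻¹ ᵗψ(x) S`, the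
  LEFT-REGULAR trace form is positive: `0 < Tr_{D/ℚ}(L_{τ(x)·x})` (`x ≠ 0`) — on a basis, `[L_{τx}] = P⁻¹ ᵗ[L_x] P` for the
  positive-definite Gram matrix `P = ᵗB (S ⊗ 1) B` of `(y, z) ↦ Tr(ᵗψ(y) S ψ(z))`, then the tree's
  `trace_inv_mul_transpose_mul_mul_self_pos`; no Wedderburn theory, no semisimplicity input;
* §2 `exists_isPositiveAntiInvolution_endAlgebra_of_uniformisation` — for `B` over a countable `K ⊆ ℂ`, an ample
  `Θ = pr₁^*Θ₀` with a uniformisation of `B_ℂ` and the Riemann form of `[𝒪(Θ)^an]` (rational Gram `G`): there is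
  `τ : End⁰_K(B) →ₗ End⁰_K(B)` with `ρ_r((τ y)_ℂ) = rosati G ρ_r(y_ℂ)` (the Rosati duals of ALL `K`-endomorphisms are
  `K`-rational, `Motives.AbelianVariety.exists_baseChange_eq_rosatiDual`), and it IS a positive anti-involution (§1 with
  `S = ᵗJ G_ℝ`, `rosati_eq_symmAdjoint`, `posDef_transpose_jMatrix_mul_latticeGram`);
* §3 **`exists_isPositiveAntiInvolution_endAlgebra`** — for EVERY abelian variety `B` over a NUMBER FIELD `E`:
  `∃ τ, IsPositiveAntiInvolution End⁰_E(B) τ`, unconditionally (choice of `E ⊆ ℂ`, `exists_isAmple_symmetric_holds`,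
  `exists_uniformisation_isRiemannForm_of_isAmple`).

USE (cell `hodgecm-mathlib`, D-0151, crux `HLiu418` = stmt-HodgeConjecture-24832, d6 card S2′): discharges the `hRosPos` binder of the
S2′ body («`∀ x, 0 ≤ Tr(L_{x·τx})`», with the source of the involution explicit) and feeds ★
`IsPositiveAntiInvolution.isSemisimpleRing_subalgebra` / `….exists_isCMField_range_eq_of_stable` (DH2 door (α), Albert).  The
file moves no book (HC_CM is proved only modulo the 7 printed citations until rung 0 closes).

## References
* [MumfordAV1970] D. Mumford, *Abelian Varieties* (1970), §20 (p. 189), §21 Thm. 1 (pp. 192–193).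
* [Shimura1998] G. Shimura, *Abelian Varieties with Complex Multiplication and Modular Functions* (1998), §1.3, §5.1
  Proposition 5 (p. 38).
* [Lange2023AbelianVarietiesComplex] H. Lange, *Abelian Varieties over the Complex Numbers* (2023), §2.4.1 Lemma 2.4.1,
  Prop. 2.4.2, Thm. 2.4.9 (pp. 113–116); §2.6.2 (positive anti-involutions).
* [Lang1982AbelianFunctions] S. Lang, *Introduction to Algebraic and Abelian Functions* (2nd ed., 1982), Ch. VII §5 Theorem 5.3.
* [Milne1986AbelianVarieties] J. S. Milne, *Abelian varieties* (1986), §17 (the Rosati involution).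
-/

noncomputable section

open CategoryTheory AlgebraicGeometry Complex Cardinal Module NumberField
open scoped Matrix Kronecker
open Literature.Geometry.Kaehler Literature.Geometry.Kaehler.ComplexTorus
open Literature.NumberTheory.Transcendental Literature.AlgebraicGeometry.HodgeTheory
open Literature.AlgebraicGeometry.Motives Literature.AlgebraicGeometry.Motives.AbelianVariety
open Literature.RingTheory.CentralSimple Literature.NumberTheory.Automorphic

namespace Literature.AlgebraicGeometry.ComplexMultiplication

/-! ### §1 Linear algebra: positivity of `Tr_D(L_{x† x})` from an adjoint pair in a faithful rational representation -/

section TracePositive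

variable {n : Type} [Fintype n] [DecidableEq n] {D : Type} [Ring D] [Algebra ℚ D] [Module.Finite ℚ D]

omit [Fintype n] [DecidableEq n] in
/-- `ℚ → ℝ` is compatible with matrix products. [folklore] -/
private theorem map_ratCast_mul' {l m : Type} [Fintype l] [Fintype m] (A : Matrix l m ℚ) (B : Matrix m n ℚ) :
    (A * B).map (Rat.cast : ℚ → ℝ) = A.map (Rat.cast : ℚ → ℝ) * B.map (Rat.cast : ℚ → ℝ) :=
  Matrix.map_mul (f := Rat.castHom ℝ)

omit [Fintype n] in
/-- Casting commutes with `A ↦ A ⊗ 1`. [folklore] -/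
private theorem map_ratCast_kronecker_one (A : Matrix n n ℚ) :
    (A ⊗ₖ (1 : Matrix n n ℚ)).map (Rat.cast : ℚ → ℝ) = A.map (Rat.cast : ℚ → ℝ) ⊗ₖ (1 : Matrix n n ℝ) := by
  ext ⟨i, j⟩ ⟨i', j'⟩
  simp only [Matrix.map_apply, Matrix.kronecker_apply, Rat.cast_mul, Matrix.one_apply]
  split_ifs <;> simp

omit [Module.Finite ℚ D] in
/-- The coordinate matrix of `ψ` on a basis intertwines `[L_y]` with `ψ(y) ⊗ 1`:
`B · [L_y] = (ψ y ⊗ 1) · B`. [folklore] -/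
private theorem coord_mul_toMatrix_lmul {d : ℕ} (ψ : D →ₐ[ℚ] Matrix n n ℚ) (b : Module.Basis (Fin d) ℚ D) (y : D) :
    Matrix.of (fun (p : n × n) (k : Fin d) => ψ (b k) p.1 p.2) * LinearMap.toMatrix b b (Algebra.lmul ℚ D y) =
      (ψ y ⊗ₖ (1 : Matrix n n ℚ)) * Matrix.of (fun (p : n × n) (k : Fin d) => ψ (b k) p.1 p.2) := by
  ext p k
  have hk : ψ (y * b k) = ∑ j, (b.repr (y * b k) j) • ψ (b j) := by
    conv_lhs => rw [← b.sum_repr (y * b k)]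
    rw [map_sum]
    exact Finset.sum_congr rfl fun j _ => by rw [map_smul]
  have hL : ∀ j, LinearMap.toMatrix b b (Algebra.lmul ℚ D y) j k = b.repr (y * b k) j := fun j => by
    rw [LinearMap.toMatrix_apply]; rfl
  have hk' : (ψ y * ψ (b k)) p.1 p.2 = ∑ j, (b.repr (y * b k) j) * ψ (b j) p.1 p.2 := by
    rw [← map_mul, hk]
    simp only [Matrix.sum_apply, Matrix.smul_apply, smul_eq_mul]
  rw [Matrix.mul_apply, Matrix.mul_apply]
  calc (∑ j, Matrix.of (fun (p : n × n) (k : Fin d) => ψ (b k) p.1 p.2) p j *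
          LinearMap.toMatrix b b (Algebra.lmul ℚ D y) j k)
      = ∑ j, (b.repr (y * b k) j) * ψ (b j) p.1 p.2 :=
        Finset.sum_congr rfl fun j _ => by rw [hL, Matrix.of_apply, mul_comm]
    _ = (ψ y * ψ (b k)) p.1 p.2 := hk'.symm
    _ = ∑ q : n × n, (ψ y ⊗ₖ (1 : Matrix n n ℚ)) p q *
          Matrix.of (fun (p : n × n) (k : Fin d) => ψ (b k) p.1 p.2) q k := by
        rw [Matrix.mul_apply, Fintype.sum_prod_type]
        refine Finset.sum_congr rfl fun i _ => ?_
        rw [Finset.sum_eq_single p.2]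
        · rw [Matrix.kronecker_apply, Matrix.one_apply_eq, mul_one, Matrix.of_apply]
        · intro j _ hj
          rw [Matrix.kronecker_apply, Matrix.one_apply_ne (Ne.symm hj), mul_zero, zero_mul]
        · intro h; exact absurd (Finset.mem_univ _) h

/-- **Positivity transfer (Lang VII Thm. 5.3 «the positivity statement also applies to the rational representation», read
backwards onto the regular representation; Mumford §21 Thm. 1).**  Let `ψ : D → M_n(ℚ)` be an injective `ℚ`-algebra homomorphism
of a finite-dimensional `ℚ`-algebra `D`, `S` a positive-definite real matrix, and `τ : D → D` a `ℚ`-linear map which is the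
`S`-ADJOINT in the representation: `ψ(τ x) = S⁻¹ ᵗψ(x) S` over `ℝ`.  Then `0 < Tr_{D/ℚ}(L_{τ(x)·x})` for `x ≠ 0`.  Proof: on a
`ℚ`-basis of `D` the matrix of `L_{τ x}` is `P⁻¹ ᵗ[L_x] P` for the positive-definite Gram matrix `P = ᵗB (S ⊗ 1) B` of
`(y, z) ↦ Tr(ᵗψ(y) S ψ(z))` (`B` injective over `ℝ` through a rational left inverse), and `Tr(P⁻¹ ᵗΦ P Φ) > 0` for `Φ ≠ 0`.
[cite: Lang1982AbelianFunctions, Ch. VII §5 Theorem 5.3 (proof)] [cite: MumfordAV1970, §21 Thm. 1] -/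
theorem leftMulTrace_pos_of_adjoint_repr (ψ : D →ₐ[ℚ] Matrix n n ℚ) (hψ : Function.Injective ψ)
    {S : Matrix n n ℝ} (hS : S.PosDef) (τ : D →ₗ[ℚ] D)
    (hτ : ∀ x : D, (ψ (τ x)).map (Rat.cast : ℚ → ℝ) = S⁻¹ * ((ψ x).map (Rat.cast : ℚ → ℝ))ᵀ * S)
    {x : D} (hx : x ≠ 0) : 0 < LinearMap.trace ℚ D (Algebra.lmul ℚ D (τ x * x)) := by
  classical
  -- a `ℚ`-basis of `D` and the coordinate matrix `B` of `ψ` on it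
  set d := Module.finrank ℚ D
  let b : Module.Basis (Fin d) ℚ D := Module.finBasis ℚ D
  let BQ : Matrix (n × n) (Fin d) ℚ := Matrix.of fun p k => ψ (b k) p.1 p.2
  let BR : Matrix (n × n) (Fin d) ℝ := BQ.map (Rat.cast : ℚ → ℝ)
  -- `B` is injective over `ℚ`
  have hBQ : Function.Injective BQ.mulVec := by
    intro v w hvw
    have hsum : ∀ u : Fin d → ℚ, ∀ p : n × n, BQ.mulVec u p = ψ (b.equivFun.symm u) p.1 p.2 := by
      intro u p
      simp only [Matrix.mulVec, dotProduct, BQ, Matrix.of_apply, b.equivFun_symm_apply, map_sum, map_smul,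
        Matrix.sum_apply, Matrix.smul_apply, smul_eq_mul]
      exact Finset.sum_congr rfl fun k _ => mul_comm _ _
    have h1 : ψ (b.equivFun.symm v) = ψ (b.equivFun.symm w) := by
      ext i j
      have := congrFun hvw (i, j)
      rwa [hsum, hsum] at this
    exact b.equivFun.symm.injective (hψ h1)
  -- hence injective over `ℝ`, by a rational left inverse
  have hBR : Function.Injective BR.mulVec := by
    obtain ⟨g, hg⟩ := LinearMap.exists_leftInverse_of_injective (Matrix.toLin' BQ)
      (LinearMap.ker_eq_bot.2 (by intro v w h; exact hBQ (by simpa [Matrix.toLin'_apply] using h)))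
    have hLB : LinearMap.toMatrix' g * BQ = 1 := by
      have := congrArg LinearMap.toMatrix' hg
      rwa [LinearMap.toMatrix'_comp, LinearMap.toMatrix'_toLin', LinearMap.toMatrix'_id] at this
    have hLBR : (LinearMap.toMatrix' g).map (Rat.cast : ℚ → ℝ) * BR = 1 := by
      rw [← map_ratCast_mul', hLB, Matrix.map_one Rat.cast Rat.cast_zero Rat.cast_one]
    intro v w hvw
    have := congrArg (((LinearMap.toMatrix' g).map (Rat.cast : ℚ → ℝ)).mulVec) hvw
    rwa [Matrix.mulVec_mulVec, Matrix.mulVec_mulVec, hLBR, Matrix.one_mulVec, Matrix.one_mulVec] at this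
  -- the positive-definite Gram matrix `P = ᵗB (S ⊗ 1) B`
  have hK : (S ⊗ₖ (1 : Matrix n n ℝ)).PosDef := hS.kronecker Matrix.PosDef.one
  set P : Matrix (Fin d) (Fin d) ℝ := BRᵀ * (S ⊗ₖ (1 : Matrix n n ℝ)) * BR with hPdef
  have hP : P.PosDef := by
    have h := hK.conjTranspose_mul_mul_same hBR
    rwa [Matrix.conjTranspose_eq_transpose_of_trivial] at h
  have hPu : IsUnit P.det := isUnit_iff_ne_zero.2 hP.det_pos.ne'
  have hSu : IsUnit S.det := isUnit_iff_ne_zero.2 hS.det_pos.ne'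
  -- matrices of left multiplications, over `ℝ`
  let Φ : D → Matrix (Fin d) (Fin d) ℝ := fun y => (LinearMap.toMatrix b b (Algebra.lmul ℚ D y)).map (Rat.cast : ℚ → ℝ)
  have hΦmul : ∀ y z : D, Φ (y * z) = Φ y * Φ z := fun y z => by
    simp only [Φ]
    rw [map_mul, Module.End.mul_eq_comp, LinearMap.toMatrix_comp b b b, map_ratCast_mul']
  -- `B Φ(y) = (ψ y ⊗ 1) B` over `ℝ`
  have hA : ∀ y : D, BR * Φ y = ((ψ y).map (Rat.cast : ℚ → ℝ) ⊗ₖ (1 : Matrix n n ℝ)) * BR := fun y => by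
    have h := congrArg (fun M : Matrix (n × n) (Fin d) ℚ => M.map (Rat.cast : ℚ → ℝ)) (coord_mul_toMatrix_lmul ψ b y)
    simp only [map_ratCast_mul'] at h
    rw [map_ratCast_kronecker_one] at h
    exact h
  -- adjointness: `P Φ(τ x) = ᵗΦ(x) P`
  have hadjP : P * Φ (τ x) = (Φ x)ᵀ * P := by
    have h1 : P * Φ (τ x) = BRᵀ * ((S * (S⁻¹ * ((ψ x).map (Rat.cast : ℚ → ℝ))ᵀ * S)) ⊗ₖ (1 : Matrix n n ℝ)) * BR := by
      rw [hPdef, Matrix.mul_assoc, hA (τ x), hτ x, ← Matrix.mul_assoc, Matrix.mul_assoc BRᵀ,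
        ← Matrix.mul_kronecker_mul, Matrix.one_mul]
    have h2 : (Φ x)ᵀ * P = BRᵀ * ((((ψ x).map (Rat.cast : ℚ → ℝ))ᵀ * S) ⊗ₖ (1 : Matrix n n ℝ)) * BR := by
      rw [hPdef, ← Matrix.mul_assoc, ← Matrix.mul_assoc, ← Matrix.transpose_mul, hA x, Matrix.transpose_mul,
        ← Matrix.kroneckerMap_transpose, Matrix.transpose_one, Matrix.mul_assoc (BRᵀ), ← Matrix.mul_kronecker_mul,
        Matrix.one_mul]
    rw [h1, h2, ← Matrix.mul_assoc S, ← Matrix.mul_assoc S, Matrix.mul_nonsing_inv S hSu, Matrix.one_mul]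
  have hadj : Φ (τ x) = P⁻¹ * (Φ x)ᵀ * P := by
    rw [Matrix.mul_assoc, ← hadjP, ← Matrix.mul_assoc, Matrix.nonsing_inv_mul P hPu, Matrix.one_mul]
  -- `Φ x ≠ 0`
  have hΦx : Φ x ≠ 0 := by
    intro h0
    have h1 : LinearMap.toMatrix b b (Algebra.lmul ℚ D x) = 0 :=
      Matrix.map_injective (Rat.cast_injective (α := ℝ)) (h0.trans (Matrix.map_zero _ Rat.cast_zero).symm)
    have h2 : Algebra.lmul ℚ D x = 0 := (LinearMap.toMatrix b b).map_eq_zero_iff.1 h1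
    have h3 := congrArg (fun f : Module.End ℚ D => f 1) h2
    simp only [Algebra.coe_lmul_eq_mul, LinearMap.mul_apply', mul_one, LinearMap.zero_apply] at h3
    exact hx h3
  -- conclude: `Tr_ℚ(L_{τx x}) = Tr(Φ(τ x) Φ x) = Tr(P⁻¹ ᵗΦ P Φ) > 0`
  have hpos : 0 < (Φ (τ x) * Φ x).trace := by
    rw [hadj]
    exact trace_inv_mul_transpose_mul_mul_self_pos hP hΦx
  have hcast : ((LinearMap.trace ℚ D (Algebra.lmul ℚ D (τ x * x)) : ℚ) : ℝ) = (Φ (τ x) * Φ x).trace := by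
    rw [← hΦmul, LinearMap.trace_eq_matrix_trace ℚ b]
    change (Rat.castHom ℝ) _ = _
    rw [AddMonoidHom.map_trace]
    rfl
  exact_mod_cast hcast ▸ hpos

end TracePositive

/-! ### §2 The Rosati involution on `End⁰_K(B)` as a positive anti-involution -/

section Rosati

variable {K : Type} [Field K] [Algebra K ℂ] (B : AbelianVariety K)
  {ι : Type} [Fintype ι] [DecidableEq ι] {Φ : (ι → ℝ) ≃L[ℝ] (Fin (B.baseChange ℂ).dim → ℂ)}
  {φ : ComplexTorus Φ → ComplexPoints (B.baseChange ℂ).X}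
  (hφ : IsAnalytification (Fin (B.baseChange ℂ).dim → ℂ) (B.baseChange ℂ).X (B.baseChange ℂ).dim φ)
  (hadd : ∀ x y, φ (x + y) = φ x * φ y)

include hφ hadd in
/-- **The Rosati involution of an `K`-rational ample divisor is a POSITIVE ANTI-INVOLUTION of `End⁰_K(B)`** (`K ⊆ ℂ` countable):
there is a `ℚ`-linear `τ : End⁰_K(B) → End⁰_K(B)`, read in the rational representation of `B_ℂ` as `ρ_r((τ y)_ℂ) = rosati G
ρ_r(y_ℂ)` (`exists_baseChange_eq_rosatiDual` for every endomorphism), with `τ(yz) = τ z · τ y`, `τ(τ y) = y`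
(`rosati_mul`, `rosati_rosati`) and `Tr_{End⁰/ℚ}(L_{τ(y)·y}) > 0` for `y ≠ 0` (Mumford §21 Thm. 1; from the positivity of
the rational representation `trace_rosati_mul_self_pos_rat` via `leftMulTrace_pos_of_adjoint_repr`).
[cite: MumfordAV1970, §20 (p. 189, the Rosati involution) and §21 Thm. 1] [cite: Shimura1998, §1.3 and §5.1 Proposition 5 (p. 38)]
[cite: Lange2023AbelianVarietiesComplex, §2.4.1 Lemma 2.4.1 and Theorem 2.4.9 (pp. 113–116)] -/
theorem exists_isPositiveAntiInvolution_endAlgebra_of_uniformisation (hK : #K ≤ ℵ₀) {Θ₀ : CartierDivisor B.X.left}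
    (hΘ : (Θ₀.pullback (B.fstX ℂ)).IsAmple)
    (p : AHData Φ) (hp : AHData.toPic p = picClass (cartierDivisorLineBundle hφ (Θ₀.pullback (B.fstX ℂ))))
    (hR : IsRiemannForm Φ p.form) {G : Matrix ι ι ℚ} (hG : G.map (Rat.cast : ℚ → ℝ) = latticeGram Φ p.form) :
    ∃ τ : B.endAlgebra →ₗ[ℚ] B.endAlgebra, IsPositiveAntiInvolution B.endAlgebra τ ∧
      ∀ y : B.endAlgebra,
        ((endAlgebraEquivOfAnalytification hφ hadd (endAlgebraBaseChange ℂ B (τ y)) : endAlgRat Φ) : Matrix ι ι ℚ) =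
          rosati G ((endAlgebraEquivOfAnalytification hφ hadd (endAlgebraBaseChange ℂ B y) : endAlgRat Φ) : Matrix ι ι ℚ) := by
  classical
  set e := endAlgebraEquivOfAnalytification hφ hadd with he
  -- the rational representation `ψ : End⁰_K(B) → M_ι(ℚ)` of `B_ℂ`, an injective `ℚ`-algebra homomorphism
  let ψ : B.endAlgebra →ₐ[ℚ] Matrix ι ι ℚ := ((endAlgRat Φ).val.comp e.toAlgHom).comp (endAlgebraBaseChange ℂ B)
  have hψ : ∀ y, ψ y = ((e (endAlgebraBaseChange ℂ B y)) : Matrix ι ι ℚ) := fun _ => rfl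
  have hψmem : ∀ y, ψ y ∈ endAlgRat Φ := fun y => by rw [hψ]; exact (e (endAlgebraBaseChange ℂ B y)).2
  have hψinj : Function.Injective ψ :=
    (Subtype.val_injective.comp e.injective).comp
      (Literature.NumberTheory.ComplexMultiplication.endAlgebraBaseChange_injective B)
  have hGu : IsUnit G.det := isUnit_det_of_map_ratCast hG (isUnit_det_latticeGram Φ hR.1 hR.2.2)
  have hGt : G.transpose = -G := transpose_eq_neg_of_map_ratCast Φ hG
  -- every `rosati G (ψ y)` is a `ψ y'`
  have hsurj : ∀ y : B.endAlgebra, ∃ y' : B.endAlgebra, ψ y' = rosati G (ψ y) := by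
    intro y
    obtain ⟨N, F, hN, hF⟩ := AbelianVariety.endAlgebra.exists_eq_algebraMap_mul_of y
    obtain ⟨d, F', hd, hF'⟩ := B.exists_baseChange_eq_rosatiDual hφ hadd hK hΘ p hp hR hG F
    refine ⟨algebraMap ℚ B.endAlgebra ((N : ℚ)⁻¹ * (d : ℚ)⁻¹) * AbelianVariety.endAlgebra.of B F', ?_⟩
    have h1 : ψ y = (N : ℚ)⁻¹ • ((endToEndAlgRat hφ hadd (Hom.baseChange ℂ F : End (B.baseChange ℂ)) : endAlgRat Φ) :
        Matrix ι ι ℚ) := by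
      rw [hψ, hF, map_mul, map_mul, AlgHom.commutes, AlgEquiv.commutes, endAlgebraBaseChange_of,
        endAlgebraEquivOfAnalytification_of, Subalgebra.coe_mul, Subalgebra.coe_algebraMap, Algebra.algebraMap_eq_smul_one,
        smul_one_mul]
    rw [hψ, map_mul, map_mul, AlgHom.commutes, AlgEquiv.commutes, endAlgebraBaseChange_of,
      endAlgebraEquivOfAnalytification_of, Subalgebra.coe_mul, Subalgebra.coe_algebraMap, Algebra.algebraMap_eq_smul_one,
      smul_one_mul, h1, rosati_smul, hF', ← Int.cast_smul_eq_zsmul ℚ d, smul_smul, mul_assoc,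
      inv_mul_cancel₀ (Int.cast_ne_zero.2 hd), mul_one]
  choose τ₀ hτ₀ using hsurj
  have hadd' : ∀ y z, τ₀ (y + z) = τ₀ y + τ₀ z := fun y z =>
    hψinj (by rw [hτ₀, map_add, rosati_add, map_add, hτ₀, hτ₀])
  have hsmul' : ∀ (c : ℚ) y, τ₀ (c • y) = c • τ₀ y := fun c y =>
    hψinj (by rw [hτ₀, map_smul, rosati_smul, map_smul, hτ₀])
  let τ : B.endAlgebra →ₗ[ℚ] B.endAlgebra := { toFun := τ₀, map_add' := hadd', map_smul' := hsmul' }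
  have hτ : ∀ y, ψ (τ y) = rosati G (ψ y) := hτ₀
  refine ⟨τ, ⟨⟨fun y z => hψinj ?_, fun y => hψinj ?_⟩, fun y hy => ?_⟩, fun y => hτ y⟩
  · rw [hτ, map_mul, rosati_mul hGu, map_mul, hτ, hτ]
  · rw [hτ, hτ, rosati_rosati hGu hGt]
  · -- positivity, through the real symmetric form `S = ᵗJ G_ℝ`
    rw [leftMulTrace_apply]
    have hS : ((jMatrix Φ).transpose * latticeGram Φ p.form).PosDef :=
      posDef_transpose_jMatrix_mul_latticeGram Φ hR.1 hR.2.2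
    refine leftMulTrace_pos_of_adjoint_repr ψ hψinj hS τ (fun z => ?_) hy
    have hz : (ψ z).map (Rat.cast : ℚ → ℝ) * jMatrix Φ = jMatrix Φ * (ψ z).map (Rat.cast : ℚ → ℝ) :=
      (mem_endAlgRat_iff Φ _).1 (hψmem z)
    rw [hτ, show (rosati G (ψ z)).map (Rat.cast : ℚ → ℝ) = (rosati G (ψ z)).map (Rat.castHom ℝ) from rfl,
      rosati_map (Rat.castHom ℝ) hGu, Rat.coe_castHom, hG, rosati_eq_symmAdjoint Φ _ hz]

end Rosati

/-! ### §3 Over a number field: the Rosati involution exists, unconditionally -/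

section Head

/-- A number field is countable. [folklore] -/
private theorem cardinalMk_le_aleph0' (E : Type) [Field E] [NumberField E] : #E ≤ ℵ₀ :=
  (Algebra.IsAlgebraic.cardinalMk_le_max ℚ E).trans (by simp)

/-- **Mumford §20–§21 over a number field, unconditionally: `End⁰_E(B)` of every abelian variety `B` over a number field `E`
carries a POSITIVE ANTI-INVOLUTION** (the Rosati involution of an `E`-rational polarisation: `τ(yz) = τ z · τ y`, `τ² = id`,
`Tr_{End⁰/ℚ}(L_{τ(y)·y}) > 0` for `y ≠ 0` — the tree's `RingTheory.CentralSimple.IsPositiveAntiInvolution`).  Proof: choose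
`E ⊆ ℂ`, an ample `Θ₀` (`exists_isAmple_symmetric_holds`), a uniformisation of `B_ℂ` with the Riemann form of `pr₁^*Θ₀`
(`exists_uniformisation_isRiemannForm_of_isAmple`) and §2.  Consumers: `IsPositiveAntiInvolution.isSemisimpleRing_subalgebra`
(stable subalgebras are semisimple), `….exists_isCMField_range_eq_of_stable` (Albert), the d6 card's `hRosPos`.
[cite: MumfordAV1970, §20 (p. 189, the Rosati involution) and §21 Thm. 1] [cite: Shimura1998, §1.3 and §5.1 Proposition 5 (p. 38)]
[cite: Milne1986AbelianVarieties, §17 (the Rosati involution)] -/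
theorem exists_isPositiveAntiInvolution_endAlgebra {E : Type} [Field E] [NumberField E] (B : AbelianVariety E) :
    ∃ τ : B.endAlgebra →ₗ[ℚ] B.endAlgebra, IsPositiveAntiInvolution B.endAlgebra τ := by
  classical
  letI : Algebra E ℂ := (Classical.choice (inferInstance : Nonempty (E →+* ℂ))).toAlgebra
  obtain ⟨Θ₀, hΘ₀, -⟩ := (AbelianVariety.exists_isAmple_symmetric_holds : B.exists_isAmple_symmetric)
  have hΘ : (Θ₀.pullback (B.fstX ℂ)).IsAmple := hΘ₀.pullback (B.fstX ℂ)
  obtain ⟨ι, _, _, Φ, φ, hφ, hadd, p, hp, hR⟩ := (B.baseChange ℂ).exists_uniformisation_isRiemannForm_of_isAmple hΘ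
  obtain ⟨G, hG⟩ := hR.exists_ratMatrix_latticeGram
  obtain ⟨τ, hτ, -⟩ := exists_isPositiveAntiInvolution_endAlgebra_of_uniformisation B hφ hadd (cardinalMk_le_aleph0' E)
    hΘ p hp hR hG
  exact ⟨τ, hτ⟩

end Head

end Literature.AlgebraicGeometry.ComplexMultiplication

end
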